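import Mathlib.Algebra.DualNumber
import Mathlib.RingTheory.MvPolynomial.Basic
import Mathlib.Data.ZMod.Basic
import Mathlib.RingTheory.Ideal.Maps
import Mathlib.Tactic.LinearCombination
import Mathlib.Tactic.Ring
import HarnessLib

/-!
# WildPinchCert — kernel-checked identities for the wild-pinch surface

`f = y² + u²·t·y + u·t²` over `𝔽₂` (res-L1-w45a-strat-1 gen 6, memo `H4LOC-KILL-WILDPINCH.md`
e222be87e80efea5, crux stmt-ResolutionOfSingularities-15315, hole 5e `stub_h4Loc`).

Certificates (pure polynomial algebra; the scheme-theoretic reading is in the memo):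
* `f_mem_frobeniusPow_origin` : `f = 1·y² + (t y)·u² + u·t²` — Fedder: `f ∈ 𝔪^[2]` at the origin
  (not F-pure there).
* `frob_witness` : `y² = (t y)·u² + u·t² + f` — so `y² ∈ (u,t)^[2] + (f)`: together with
  `y_not_mem_span` the parameter ideal `(u,t)` of `𝒪_b` is not Frobenius-closed (b is bad).
* `y_not_mem_span` : `y ∉ (u, t, f)` — via the evaluation `u,t ↦ 0`, `y ↦ ε` into the local ring
  `DualNumber 𝔽₂` (elements outside `𝔪 = (u,t,y)` go to units, so the same evaluation shows
  `y ∉ (u,t,f)·𝔽₂[u,t,y]_𝔪`).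
* `f_not_mem_frobeniusPow_at_one` : `f ∉ ((u-1)², t², y²)` — Fedder: F-pure at the point
  `(1,0,0)` of the double curve `D = {t = y = 0}` (the image of `f` is `ε₂ ε₁ ≠ 0` in
  `DualNumber (DualNumber 𝔽₂)`).
* `blowup_u_chart`, `blowup_t_chart`, `blowup_y_chart` : the three affine charts of the blow-up of
  the origin; the `u`-chart strict transform is `f` again (self-reproduction), valid over any
  commutative ring.
* `lemmaQ_cert_char2` : `(1 + u S)·(S² + u² S + u) = u + S² + u S³ + u³ S² + 2·u² S`, i.e. on the
  curve `D̄ = {S² + u²S + u = 0}` in characteristic 2, `u = S²·(1 + uS + u³)`: the uniformiser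
  relation `u ≡ S² (mod S³)` used in Lemma Q(a) (`1/S² = 1/u + S + u² ∈ k(u) + 𝒪_{D̄,q}`).
OURS; AI-written; no `sorry`; standard axioms.

TREE LANDING (res-L1-w45a-plan-1 R13.38 (2); filer res-L1-w45a-stub-2): text = res-L1-w45a-strat-1's `L/res-L1-w45a-strat-1/WildPinchCert.lean`
sha16 d59e6ff7b1d599a5 VERBATIM up to tree boilerplate (namespace prefix, narrowed imports, docstrings on every declaration). Support file for crux
stmt-ResolutionOfSingularities-15315 (`FrobeniusLadder.FInjectiveMacaulayfication`), `--supports … --as helper`: the Lean half of the ON-PAPER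
refutation of the 5e stub `stub_h4Loc` of door v29 (memo e222be87e80efea5; referees tri-2 af5aa3bd02af3b2f, tri-1 f13a957bbeb6e57b; R13.34) — these
are the kernel-checkable identities the memo uses; the scheme-theoretic conclusion `¬ H4Loc` is NOT claimed here. [OURS · L1 W4.5a] AI-written;
AI review is weaker than expert review; no statement of any manuscript is used; no named fact. [folklore]
-/

-- single-problem summit: the doubled namespace component is forced
set_option linter.dupNamespace false

namespace Summit.ResolutionOfSingularities.ResolutionOfSingularities.Theorems.FInjectiveMacaulayfication.WildPinchCert

open MvPolynomial DualNumber

noncomputable section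

/-- the coordinate ring of `𝔸³` over `𝔽₂` -/
abbrev R := MvPolynomial (Fin 3) (ZMod 2)

/-- coordinate `u` -/
def u : R := X 0
/-- coordinate `t` -/
def t : R := X 1
/-- coordinate `y` -/
def y : R := X 2

/-- the wild-pinch equation `y² + u² t y + u t²` -/
def f : R := y ^ 2 + u ^ 2 * t * y + u * t ^ 2

/-- `2 = 0` in `𝔽₂[u,t,y]`. -/
theorem two_eq_zero : (2 : R) = 0 := by
  have h := CharP.cast_eq_zero R 2
  simpa using h

/-- Fedder at the origin: `f ∈ (u², t², y²) = 𝔪^[2]`. -/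
theorem f_mem_frobeniusPow_origin : f = 1 * y ^ 2 + (t * y) * u ^ 2 + u * t ^ 2 := by
  unfold f; ring

/-- `f ∈ (u², t², y²)`. -/
theorem f_mem_span_origin : f ∈ Ideal.span ({u ^ 2, t ^ 2, y ^ 2} : Set R) := by
  rw [f_mem_frobeniusPow_origin]
  refine Ideal.add_mem _ (Ideal.add_mem _ ?_ ?_) ?_
  · exact Ideal.mul_mem_left _ _ (Ideal.subset_span (by simp))
  · exact Ideal.mul_mem_left _ _ (Ideal.subset_span (by simp))
  · exact Ideal.mul_mem_left _ _ (Ideal.subset_span (by simp))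

/-- The Frobenius witness: `y² ∈ (u², t²) + (f)`, with explicit cofactors (characteristic 2). -/
theorem frob_witness : y ^ 2 = (t * y) * u ^ 2 + u * t ^ 2 + f := by
  unfold f
  linear_combination (-(t * y * u ^ 2 + u * t ^ 2)) * two_eq_zero

/-- `y² ∈ (u², t², f)`. -/
theorem ysq_mem : y ^ 2 ∈ Ideal.span ({u ^ 2, t ^ 2, f} : Set R) := by
  rw [frob_witness]
  refine Ideal.add_mem _ (Ideal.add_mem _ ?_ ?_) ?_
  · exact Ideal.mul_mem_left _ _ (Ideal.subset_span (by simp))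
  · exact Ideal.mul_mem_left _ _ (Ideal.subset_span (by simp))
  · exact Ideal.subset_span (by simp)

/-- evaluation `u, t ↦ 0`, `y ↦ ε` into the dual numbers over `𝔽₂` -/
def φ : R →ₐ[ZMod 2] DualNumber (ZMod 2) := aeval ![0, 0, ε]

/-- `φ u = 0` -/
@[simp] theorem φ_u : φ u = 0 := by simp [φ, u]
/-- `φ t = 0` -/
@[simp] theorem φ_t : φ t = 0 := by simp [φ, t]
/-- `φ y = ε` -/
@[simp] theorem φ_y : φ y = ε := by simp [φ, y]
/-- `φ f = 0` -/
@[simp] theorem φ_f : φ f = 0 := by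
  simp [f, map_add, map_mul, pow_two]

/-- `ε ≠ 0` in the dual numbers over a nontrivial semiring. -/
theorem eps_ne_zero' {A : Type*} [Semiring A] [Nontrivial A] : (ε : DualNumber A) ≠ 0 := by
  intro h
  have := congrArg TrivSqZeroExt.snd h
  simp at this

/-- `ε ≠ 0` in `DualNumber 𝔽₂`. -/
theorem eps_ne_zero : (ε : DualNumber (ZMod 2)) ≠ 0 := eps_ne_zero'

/-- `y ∉ (u, t, f)`: the class of `y` in `𝔽₂[u,t,y]/(u,t,f) ≅ 𝔽₂[y]/(y²)` is nonzero. -/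
theorem y_not_mem_span : y ∉ Ideal.span ({u, t, f} : Set R) := by
  intro hy
  have hle : Ideal.span ({u, t, f} : Set R) ≤ RingHom.ker (φ : R →+* DualNumber (ZMod 2)) := by
    rw [Ideal.span_le]
    intro x hx
    simp only [Set.mem_insert_iff, Set.mem_singleton_iff] at hx
    rcases hx with rfl | rfl | rfl <;> simp [RingHom.mem_ker]
  have := hle hy
  rw [RingHom.mem_ker] at this
  exact eps_ne_zero (by simpa using this)

/-- the two nilpotents of `DualNumber (DualNumber 𝔽₂)`: `ε₁ = ε` (outer), `ε₂ = inl ε` (inner) -/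
def ε₁ : DualNumber (DualNumber (ZMod 2)) := ε
/-- the inner nilpotent `ε₂ = inl ε` -/
def ε₂ : DualNumber (DualNumber (ZMod 2)) := TrivSqZeroExt.inl ε

/-- `ε₁² = 0` -/
theorem ε₁_sq : ε₁ * ε₁ = 0 := by simp [ε₁]

/-- `ε₂² = 0` -/
theorem ε₂_sq : ε₂ * ε₂ = 0 := by
  show TrivSqZeroExt.inl ε * TrivSqZeroExt.inl ε = (0 : DualNumber (DualNumber (ZMod 2)))
  rw [← TrivSqZeroExt.inl_mul, DualNumber.eps_mul_eps, TrivSqZeroExt.inl_zero]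

/-- `ε₂ ε₁ = inr ε` -/
theorem ε₂_mul_ε₁ : ε₂ * ε₁ = TrivSqZeroExt.inr ε := by
  ext <;> simp [ε₁, ε₂]

/-- `ε₂ ε₁ ≠ 0` -/
theorem ε₂_mul_ε₁_ne_zero : ε₂ * ε₁ ≠ 0 := by
  rw [ε₂_mul_ε₁]
  intro h
  have := congrArg TrivSqZeroExt.snd h
  simp at this
  exact eps_ne_zero this

/-- evaluation at the point `(1,0,0)` of the double curve with first-order thickenings:
`u ↦ 1`, `t ↦ ε₁`, `y ↦ ε₂` -/
def ψ : R →ₐ[ZMod 2] DualNumber (DualNumber (ZMod 2)) := aeval ![1, ε₁, ε₂]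

/-- `ψ u = 1` -/
@[simp] theorem ψ_u : ψ u = 1 := by simp [ψ, u]
/-- `ψ t = ε₁` -/
@[simp] theorem ψ_t : ψ t = ε₁ := by simp [ψ, t]
/-- `ψ y = ε₂` -/
@[simp] theorem ψ_y : ψ y = ε₂ := by simp [ψ, y]

/-- `ψ f = ε₂ ε₁` -/
theorem ψ_f : ψ f = ε₂ * ε₁ := by
  have h1 : ψ f = ε₂ ^ 2 + (1 : DualNumber (DualNumber (ZMod 2))) ^ 2 * ε₁ * ε₂ + 1 * ε₁ ^ 2 := by
    simp only [f, map_add, map_mul, map_pow, ψ_u, ψ_t, ψ_y]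
  have e1 : ε₁ ^ 2 = 0 := by rw [pow_two]; exact ε₁_sq
  have e2 : ε₂ ^ 2 = 0 := by rw [pow_two]; exact ε₂_sq
  rw [h1, e1, e2]
  ring

/-- Fedder off the origin: `f ∉ ((u-1)², t², y²)`, so `𝔽₂[u,t,y]/(f)` is F-pure at `(1,0,0) ∈ D`. -/
theorem f_not_mem_frobeniusPow_at_one :
    f ∉ Ideal.span ({(u - 1) ^ 2, t ^ 2, y ^ 2} : Set R) := by
  intro hf
  have hle : Ideal.span ({(u - 1) ^ 2, t ^ 2, y ^ 2} : Set R)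
      ≤ RingHom.ker (ψ : R →+* DualNumber (DualNumber (ZMod 2))) := by
    rw [Ideal.span_le]
    intro x hx
    simp only [Set.mem_insert_iff, Set.mem_singleton_iff] at hx
    rcases hx with rfl | rfl | rfl
    · simp [RingHom.mem_ker, map_pow, map_sub]
    · simp [RingHom.mem_ker, pow_two, ε₁_sq]
    · simp [RingHom.mem_ker, pow_two, ε₂_sq]
  have := hle hf
  rw [RingHom.mem_ker] at this
  exact ε₂_mul_ε₁_ne_zero (by simpa [ψ_f] using this)

/-- the wild-pinch cubic as a polynomial function over any commutative ring -/
def F {S : Type*} [CommRing S] (a b c : S) : S := c ^ 2 + a ^ 2 * b * c + a * b ^ 2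

/-- Blow-up of the origin, `u`-chart (`t = u t₁`, `y = u y₁`): the strict transform is `F` again. -/
theorem blowup_u_chart {S : Type*} [CommRing S] (a b₁ c₁ : S) :
    F a (a * b₁) (a * c₁) = a ^ 2 * F a b₁ c₁ := by
  unfold F; ring

/-- `t`-chart (`u = t u₂`, `y = t y₂`): strict transform `y₂² + t u₂ + t² u₂² y₂` (an `A₁`-type point). -/
theorem blowup_t_chart {S : Type*} [CommRing S] (b a₂ c₂ : S) :
    F (b * a₂) b (b * c₂) = b ^ 2 * (c₂ ^ 2 + b * a₂ + b ^ 2 * a₂ ^ 2 * c₂) := by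
  unfold F; ring

/-- `y`-chart (`u = y u₃`, `t = y t₃`): strict transform `1 + y² u₃² t₃ + y u₃ t₃²` (no point over the origin). -/
theorem blowup_y_chart {S : Type*} [CommRing S] (c a₃ b₃ : S) :
    F (c * a₃) (c * b₃) c = c ^ 2 * (1 + c ^ 2 * a₃ ^ 2 * b₃ + c * a₃ * b₃ ^ 2) := by
  unfold F; ring

/-- Lemma Q(a) certificate for `p = 2`: on `D̄ = {S² + u²S + u = 0}`, in characteristic 2,
`u = S² (1 + u S + u³)`; hence `u ≡ S² (mod S³)` at `q` and `1/S² = 1/u + S + u²`. -/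
theorem lemmaQ_cert_char2 {S' : Type*} [CommRing S'] (a s : S') :
    (1 + a * s) * (s ^ 2 + a ^ 2 * s + a) = a + (s ^ 2 + a * s ^ 3 + a ^ 3 * s ^ 2) + 2 * (a ^ 2 * s) := by
  ring

/-- Lemma Q(a) consequence in characteristic `2`: on `D̄`, `u = S²(1 + uS + u³)`. -/
theorem lemmaQ_cert_char2' {S' : Type*} [CommRing S'] [CharP S' 2] (a s : S')
    (hP : s ^ 2 + a ^ 2 * s + a = 0) : a = s ^ 2 * (1 + a * s + a ^ 3) := by
  have h2 : (2 : S') = 0 := by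
    have h := CharP.cast_eq_zero S' 2
    simpa using h
  have hc := lemmaQ_cert_char2 a s
  rw [hP, mul_zero] at hc
  linear_combination (-1 : S') * hc - (s ^ 2 + a * s ^ 3 + a ^ 3 * s ^ 2 + a ^ 2 * s) * h2

end

end Summit.ResolutionOfSingularities.ResolutionOfSingularities.Theorems.FInjectiveMacaulayfication.WildPinchCert
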